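import Literature.NumberTheory.EllipticCurves.KodairaNeronMultiplicativeProofs
import Literature.NumberTheory.EllipticCurves.KodairaNeronSplitCyclicProofs
import Literature.NumberTheory.EllipticCurves.SelmerFiniteProofs
import Literature.RingTheory.DiscreteValuationRing.AdicCompletionHensel
import HarnessLib

/-!
# The Tate normal form over `K_v^nr`: the component classes are `K_v`-rational, and the Galois
# group acts trivially on `E(K_v^nr)/E₀(K_v^nr)`

`Proofs` file (theorems only, no definitions, no named facts) in topic
`NumberTheory/EllipticCurves`; second bottom-up step (after `UnramifiedLayerTorusNormProofs`) of
the arithmetic half of the named fact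
`Literature.Barriers.BirchSwinnertonDyer.Matsuno2009_lemma41_local` (K. Matsuno, Math. Res.
Lett. **16** (2009), Lemma 4.1, p. 454), whose printed proof uses: "by the assumption (i) [split
multiplicative reduction] and the fact that `L/ℚ_ℓ` is unramified, `E(L)/E₀(L)` is a cyclic
group of order `c_ℓ` **and `G₀ = Gal(L/ℚ_ℓ)` acts trivially on it**" (Silverman, *ATAEC*,
Cor. IV.9.2(d); on the Tate curve, `K^*/q^ℤ ↠ ℤ/c`, the valuation, is Galois invariant).

We prove this for the Tate normal form `J : y² + xy = x³ + αϖᶜ` over the valuation ring `𝓞_v` of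
the completion `K_v` of a number field at a finite place `v` (`α ∈ 𝓞_vˣ`, `ϖ` a uniformiser,
`c ≥ 1`; every elliptic curve with split multiplicative reduction at `v` has such a model,
`WeierstrassCurve.exists_variableChange_localMinimalIntegralModel_eq_tateNormalForm`), on the
standard carrier of the tree: the points of `V = X ⊗ K̄_v`, `X = J ⊗ K_v`, with `Γ_{K_v}` acting
through `absoluteGaloisGroup.toAlgEquiv`, the spectral valuation `w` (`hw`), the prime `𝔐` of
`\bar 𝓞_v` with its inertia group `I_𝔐` (fixed field `K_v^nr`), and `E₀` = the points `P` with
`Literature.NumberTheory.EllipticCurves.ReducesToNonsingular w (residue 𝒪_w) P`: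

* `exists_generator_of_tateNormalForm` (over `𝓞_v`): there is a `K_v`-point `g₀` of `X` whose
  class generates `X(K_v)/E₀(K_v) ≅ ℤ/c`: `i • g₀ ∈ E₀ ↔ c ∣ i` (cyclicity and order,
  `LocalIndex.isAddCyclic_quotient_of_tateNormalForm`, `LocalIndex.index_eq_of_tateNormalForm`,
  `𝓞_v` being henselian);
* `exists_rational_generator_of_tateNormalForm` (**main**): there is a point `g ∈ V(K̄_v)` fixed
  by all of `Γ_{K_v}` (the image of `g₀`) such that (a) `i • g ∈ E₀ ↔ c ∣ i`, and (b) every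
  point `P` fixed by `I_𝔐` (a point of `E(K_v^nr)`) satisfies `P - i • g ∈ E₀` for some `i < c`
  — i.e. **`E(K_v^nr)/E₀(K_v^nr)` is cyclic of order `c`, generated by the class of a
  `K_v`-rational point**.  Proof of (b): over the henselian discrete valuation ring `𝒪ⁿʳ` of
  `K_v^nr` (`MaxUnramifiedIntegersProofs`) the equation `J ⊗ 𝒪ⁿʳ` is again a Tate normal form
  with the same `c` (`ϖ` stays a uniformiser: the extension is unramified), so
  `E(K_v^nr)/E₀(K_v^nr)` has at most `c` elements (`LocalIndex.natCard_quotient_le_of_tateNormalForm`,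
  Silverman *ATAEC* Lemma V.4.1.2–4 in reverse), while the classes of `i • g₀`, `i < c`, are
  pairwise distinct there (`E₀(K_v^nr) ∩ X(K_v) = E₀(K_v)`); the plumbing `J(K_v^nr) ≃ X(K_v^nr)
  → X(K̄_v)`, "`I_𝔐`-fixed points come from `K_v^nr`", "`E₀` over `𝒪ⁿʳ` is `E₀` over `𝒪_w`" is
  that of `kodairaNeron_exists_finset_reducesToNonsingular_of_hasMultiplicativeReduction`
  (`KodairaNeronMultiplicativeProofs`), verbatim;
* `reducesToNonsingular_map_iff_of_forall_eq` (general): `E₀` is stable under every isometric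
  `K_v`-automorphism of `K̄_v` (the induced residue-field endomorphism fixes the reduced equation);
* `reducesToNonsingular_map_sub_of_tateNormalForm` (**corollary**): for every `σ ∈ Γ_{K_v}` and
  every `I_𝔐`-fixed `P`, `σP - P ∈ E₀` — the triviality of the Galois action on
  `E(K_v^nr)/E₀(K_v^nr)`, hence on `E(L)/E₀(L)` for every unramified `L/K_v`.

## References

* [Matsuno2009] K. Matsuno, Math. Res. Lett. 16 (2009), no. 3, 449–461, proof of Lemma 4.1.
* [SilvermanATAEC1994] J. H. Silverman, *Advanced Topics in the Arithmetic of Elliptic Curves*,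
  GTM 151 (1994), Cor. IV.9.2(d) and Rem. IV.9.6 (PDF pp. 340, 355), V.4 Lemmas 4.1.1–4.1.4.
* [SilvermanAEC2009] J. H. Silverman, *The Arithmetic of Elliptic Curves*, 2nd ed. (2009),
  VII.2.1, VII.5.4(a), VII.6.1.

## Design

No definitions, no local notation (types are spelled out as in `KodairaNeronMultiplicativeProofs`);
`noncomputable section`; `open scoped Classical NNReal`; one universe `u`.  The Tate normal form is
passed as `J` with the seven hypotheses `h1 h2 h3 h4 hα hc h6` of the `LocalIndex` theorems.
`set_option maxHeartbeats` is raised on the two heavy theorems (coercions through `𝒪ⁿʳ`), as in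
the template file.  Axioms: `propext`, `Classical.choice`, `Quot.sound`.
-/

noncomputable section

open scoped Classical NNReal
open NumberField IsDedekindDomain Field Polynomial IsLocalRing

universe u

/-! ## `E₀ ⊆ E(K̄_v)` is stable under isometric automorphisms -/

namespace Literature.NumberTheory.EllipticCurves

section Isometry

variable {F₀ : Type*} [Field F₀] {L : Type u} [Field L] [Algebra F₀ L] {w : Valuation L ℝ≥0}
  (X : WeierstrassCurve F₀)

/-- **`E₀` is stable under isometric automorphisms fixing the equation.**  Let `X` be a
Weierstrass equation over a subfield `F₀ ⊆ L`, `w` a valuation on `L` for which `X ⊗ L` is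
`w`-integral, and `σ` an `F₀`-algebra endomorphism of `L` with `w (σ z) = w z`.  Then a point
`P` of `X ⊗ L` reduces to a nonsingular point (for the residue map of `𝒪_w`) iff `σ P` does:
`σ` induces a ring endomorphism `σ̄` of the residue field with `σ̄ z̄ = \overline{σ z}`, which
fixes the reduced equation (its coefficients come from `F₀`), and nonsingularity is invariant
under the injective `σ̄` (Mathlib `Affine.map_nonsingular`).  Neukirch, *ANT*, II §9 (the
decomposition group acts on the residue field); Silverman, *AEC*, VII.2. [folklore] -/
theorem reducesToNonsingular_map_iff_of_forall_eq
    [hV : (X.baseChange L).IsIntegral w.integer] (σ : L →ₐ[F₀] L) (hσ : ∀ z, w (σ z) = w z)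
    (P : (X.baseChange L).toAffine.Point) :
    ReducesToNonsingular w (IsLocalRing.residue w.integer) (WeierstrassCurve.Affine.Point.map σ P) ↔
      ReducesToNonsingular w (IsLocalRing.residue w.integer) P := by
  -- `σ` on `𝒪_w` and on the residue field
  let σR : w.integer →+* w.integer :=
    { toFun := fun a ↦ ⟨σ a, by rw [Valuation.mem_integer_iff, hσ]; exact a.2⟩
      map_one' := Subtype.ext (by simp)
      map_mul' := fun a b ↦ Subtype.ext (by simp)
      map_zero' := Subtype.ext (by simp)
      map_add' := fun a b ↦ Subtype.ext (by simp) }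
  have hσR : ∀ a : w.integer, (σR a : L) = σ a := fun _ ↦ rfl
  haveI : IsLocalHom σR := ⟨fun a ha ↦ by
    rw [Valuation.Integers.isUnit_iff_valuation_eq_one (Valuation.integer.integers w)] at ha ⊢
    change w ((σR a : w.integer) : L) = 1 at ha
    rwa [hσR, hσ] at ha⟩
  set σk : IsLocalRing.ResidueField w.integer →+* IsLocalRing.ResidueField w.integer :=
    IsLocalRing.ResidueField.map σR with hσk
  have hσk : ∀ a : w.integer, σk (IsLocalRing.residue w.integer a) =
      IsLocalRing.residue w.integer (σR a) := fun a ↦ by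
    rw [hσk]; rfl
  -- the reduced equation is fixed by `σ̄`
  have hcoef : ∀ (a : F₀) (ha : w (algebraMap F₀ L a) ≤ 1),
      σR ⟨algebraMap F₀ L a, ha⟩ = ⟨algebraMap F₀ L a, ha⟩ := fun a ha ↦
    Subtype.ext (by rw [hσR]; exact σ.commutes a)
  have ha₁ : w (X.baseChange L).a₁ ≤ 1 := val_a₁_le_one
  have ha₂ : w (X.baseChange L).a₂ ≤ 1 := val_a₂_le_one
  have ha₃ : w (X.baseChange L).a₃ ≤ 1 := val_a₃_le_one
  have ha₄ : w (X.baseChange L).a₄ ≤ 1 := val_a₄_le_one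
  have ha₆ : w (X.baseChange L).a₆ ≤ 1 := val_a₆_le_one
  have hc₁ : σR ⟨(X.baseChange L).a₁, ha₁⟩ = ⟨(X.baseChange L).a₁, ha₁⟩ := hcoef X.a₁ ha₁
  have hc₂ : σR ⟨(X.baseChange L).a₂, ha₂⟩ = ⟨(X.baseChange L).a₂, ha₂⟩ := hcoef X.a₂ ha₂
  have hc₃ : σR ⟨(X.baseChange L).a₃, ha₃⟩ = ⟨(X.baseChange L).a₃, ha₃⟩ := hcoef X.a₃ ha₃
  have hc₄ : σR ⟨(X.baseChange L).a₄, ha₄⟩ = ⟨(X.baseChange L).a₄, ha₄⟩ := hcoef X.a₄ ha₄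
  have hc₆ : σR ⟨(X.baseChange L).a₆, ha₆⟩ = ⟨(X.baseChange L).a₆, ha₆⟩ := hcoef X.a₆ ha₆
  have hred : (reduceCurve (IsLocalRing.residue w.integer) (X.baseChange L)).map σk =
      reduceCurve (IsLocalRing.residue w.integer) (X.baseChange L) := by
    ext
    · rw [WeierstrassCurve.map_a₁, reduceCurve_a₁, reduceFun_of_le _ ha₁, hσk, hc₁]
    · rw [WeierstrassCurve.map_a₂, reduceCurve_a₂, reduceFun_of_le _ ha₂, hσk, hc₂]
    · rw [WeierstrassCurve.map_a₃, reduceCurve_a₃, reduceFun_of_le _ ha₃, hσk, hc₃]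
    · rw [WeierstrassCurve.map_a₄, reduceCurve_a₄, reduceFun_of_le _ ha₄, hσk, hc₄]
    · rw [WeierstrassCurve.map_a₆, reduceCurve_a₆, reduceFun_of_le _ ha₆, hσk, hc₆]
  rcases P with _ | ⟨x, y, h⟩
  · rw [show (WeierstrassCurve.Affine.Point.zero : (X.baseChange L).toAffine.Point) = 0 from rfl,
      map_zero]
  · rw [WeierstrassCurve.Affine.Point.map_some, reducesToNonsingular_some_iff,
      reducesToNonsingular_some_iff, hσ]
    by_cases hx : 1 < w x
    · simp only [hx, true_or]
    · rw [or_iff_right hx, or_iff_right hx]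
      have hx1 : w x ≤ 1 := not_lt.mp hx
      have hy1 : w y ≤ 1 := val_y_le_one (w := w) (V := X.baseChange L) h.1 hx1
      have hσx1 : w (σ x) ≤ 1 := by rw [hσ]; exact hx1
      have hσy1 : w (σ y) ≤ 1 := by rw [hσ]; exact hy1
      rw [reduceFun_of_le _ hx1, reduceFun_of_le _ hy1, reduceFun_of_le _ hσx1,
        reduceFun_of_le _ hσy1]
      have ex : (⟨σ x, hσx1⟩ : w.integer) = σR ⟨x, hx1⟩ := Subtype.ext rfl
      have ey : (⟨σ y, hσy1⟩ : w.integer) = σR ⟨y, hy1⟩ := Subtype.ext rfl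
      rw [ex, ey, ← hσk, ← hσk]
      conv_lhs => rw [← hred]
      exact WeierstrassCurve.Affine.map_nonsingular _ σk.injective _ _

end Isometry

end Literature.NumberTheory.EllipticCurves

namespace IsDedekindDomain.HeightOneSpectrum

open Literature.NumberTheory.EllipticCurves Literature.NumberTheory.EllipticCurves.LocalIndex
  Literature.NumberTheory.GaloisRepresentations
  Literature.NumberTheory.GaloisRepresentations.IsNonarchimedeanLocalField

variable {K : Type u} [Field K] [NumberField K] {v : HeightOneSpectrum (𝓞 K)}
  {w : Valuation (AlgebraicClosure (v.adicCompletion K)) ℝ≥0}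
  (hw : ∀ x, (w x : ℝ) = spectralNorm (v.adicCompletion K) (AlgebraicClosure (v.adicCompletion K)) x)

/-! ## Over `𝓞_v`: a `K_v`-rational generator of `X(K_v)/E₀(K_v) ≅ ℤ/c` -/

/-- **A generator of the component group over `K_v`.**  For the Tate normal form
`J : y² + xy = x³ + αϖᶜ` over `𝓞_v` (`α` a unit, `ϖ` a uniformiser, `c ≥ 1`) there is a point
`g₀ ∈ X(K_v)`, `X = J ⊗ K_v`, with `i • g₀ ∈ E₀(K_v) ↔ c ∣ i`: the quotient `X(K_v)/E₀(K_v)` is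
cyclic (`LocalIndex.isAddCyclic_quotient_of_tateNormalForm`, `𝓞_v` being complete hence henselian)
of order `c` (`LocalIndex.index_eq_of_tateNormalForm`), and `g₀` represents a generator.
Silverman, *ATAEC*, Cor. IV.9.2(d). [cite: SilvermanATAEC1994, Cor. IV.9.2(d) (PDF p. 340)] -/
theorem exists_generator_of_tateNormalForm (J : WeierstrassCurve (v.adicCompletionIntegers K))
    {ϖ α : v.adicCompletionIntegers K} {c : ℕ} (hϖ : Irreducible ϖ) (h1 : J.a₁ = 1)
    (h2 : J.a₂ = 0) (h3 : J.a₃ = 0) (h4 : J.a₄ = 0) (hα : IsUnit α) (hc : 1 ≤ c)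
    (h6 : J.a₆ = α * ϖ ^ c) :
    ∃ g₀ : (J.baseChange (v.adicCompletion K)).toAffine.Point,
      ∀ i : ℕ, J.HasNonsingularReduction (i • g₀) ↔ c ∣ i := by
  haveI : HenselianLocalRing (v.adicCompletionIntegers K) := inferInstance
  set H := J.nonsingularReductionSubgroup
    (integers_valuationRing_valuation (v.adicCompletionIntegers K) (v.adicCompletion K)) with hH
  have hidx : H.index = c :=
    index_eq_of_tateNormalForm (K := v.adicCompletion K) J hϖ h1 h2 h3 h4 hα hc h6
  haveI hcyc : IsAddCyclic ((J.baseChange (v.adicCompletion K)).toAffine.Point ⧸ H) :=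
    isAddCyclic_quotient_of_tateNormalForm (K := v.adicCompletion K) J hϖ h1 h2 h3 h4 hα hc h6
  obtain ⟨gbar, hgbar⟩ := IsAddCyclic.exists_ofOrder_eq_natCard
    (α := (J.baseChange (v.adicCompletion K)).toAffine.Point ⧸ H)
  have hcard : Nat.card ((J.baseChange (v.adicCompletion K)).toAffine.Point ⧸ H) = c := hidx
  rw [hcard] at hgbar
  obtain ⟨g₀, rfl⟩ := QuotientAddGroup.mk_surjective gbar
  refine ⟨g₀, fun i ↦ ?_⟩
  rw [← hgbar, addOrderOf_dvd_iff_nsmul_eq_zero, ← QuotientAddGroup.mk_nsmul,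
    QuotientAddGroup.eq_zero_iff]
  exact Iff.rfl

/-! ## Over `K̄_v`: the classes of `E(K_v^nr)/E₀` are those of the multiples of a rational point -/

include hw in
set_option maxHeartbeats 4000000 in
/-- **The component classes of `E(K_v^nr)` at a split multiplicative place are represented by the
multiples of a `K_v`-rational point.**  For the Tate normal form `J : y² + xy = x³ + αϖᶜ` over
`𝓞_v` and `V = (J ⊗ K_v) ⊗ K̄_v` there is `g ∈ V(K̄_v)`, fixed by every `σ ∈ Γ_{K_v}`, such that
(a) `i • g ∈ E₀ ↔ c ∣ i` and (b) every `I_𝔐`-fixed point `P` (a point of `E(K_v^nr)`) has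
`P - i • g ∈ E₀` for some `i < c`.  So `E(K_v^nr)/E₀(K_v^nr) ≅ ℤ/c` is generated by the class
of a `K_v`-rational point (Silverman, *ATAEC*, Cor. IV.9.2(d) over the henselian `𝒪ⁿʳ`, with
Prop. VII.5.4(a) of *AEC*: the minimal equation stays minimal, indeed stays a Tate normal form
with the same `c`, over the unramified extension).  This is the input "`G₀` acts trivially on
`E(L)/E₀(L) ≅ ℤ/c_ℓ`" of Matsuno's Lemma 4.1.
[cite: SilvermanATAEC1994, Cor. IV.9.2(d) (PDF p. 340)] [cite: Matsuno2009, Lemma 4.1 (proof)] -/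
theorem exists_rational_generator_of_tateNormalForm {𝔐 : Ideal v.localAbsIntegers}
    (h𝔐 : 𝔐 ∈ v.localPrimesAbove) (J : WeierstrassCurve (v.adicCompletionIntegers K))
    {ϖ α : v.adicCompletionIntegers K} {c : ℕ} (hϖ : Irreducible ϖ) (h1 : J.a₁ = 1)
    (h2 : J.a₂ = 0) (h3 : J.a₃ = 0) (h4 : J.a₄ = 0) (hα : IsUnit α) (hc : 1 ≤ c)
    (h6 : J.a₆ = α * ϖ ^ c) :
    ∃ g : ((J.baseChange (v.adicCompletion K)).baseChange (AlgebraicClosure (v.adicCompletion K))).toAffine.Point,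
      (∀ σ : absoluteGaloisGroup (v.adicCompletion K),
        WeierstrassCurve.Affine.Point.map ((absoluteGaloisGroup.toAlgEquiv _ σ :
          AlgebraicClosure (v.adicCompletion K) ≃ₐ[v.adicCompletion K] AlgebraicClosure (v.adicCompletion K)) :
          AlgebraicClosure (v.adicCompletion K) →ₐ[v.adicCompletion K] AlgebraicClosure (v.adicCompletion K)) g = g) ∧
      (∀ i : ℕ, ReducesToNonsingular w (IsLocalRing.residue w.integer) (i • g) ↔ c ∣ i) ∧
      ∀ P : ((J.baseChange (v.adicCompletion K)).baseChange (AlgebraicClosure (v.adicCompletion K))).toAffine.Point,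
        (∀ τ ∈ 𝔐.inertia (absoluteGaloisGroup (v.adicCompletion K)),
          WeierstrassCurve.Affine.Point.map ((absoluteGaloisGroup.toAlgEquiv _ τ :
            AlgebraicClosure (v.adicCompletion K) ≃ₐ[v.adicCompletion K] AlgebraicClosure (v.adicCompletion K)) :
            AlgebraicClosure (v.adicCompletion K) →ₐ[v.adicCompletion K] AlgebraicClosure (v.adicCompletion K)) P = P) →
        ∃ i < c, ReducesToNonsingular w (IsLocalRing.residue w.integer) (P - i • g) := by
  -- the classical decidable equality on `K_v^nr`, as in the index theorems of the tree
  letI instDec : DecidableEq (maxUnramified (v.adicCompletion K)) := fun a b => Classical.propDecidable (a = b)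
  haveI := isDiscreteValuationRing_unrIntegers hw
  haveI := henselianLocalRing_unrIntegers hw
  obtain ⟨φ, hφ⟩ := exists_ringHom_adicCompletionIntegers_unrIntegers hw
  obtain ⟨ψ, hψ⟩ := exists_ringHom_unrIntegers_integer (w := w)
  have hvR := integers_valuationRing_valuation (Valuation.valuationSubring (Valuation.comap (algebraMap (maxUnramified (v.adicCompletion K)) (AlgebraicClosure (v.adicCompletion K))) w)) (maxUnramified (v.adicCompletion K))
  have hv₀ := integers_valuationRing_valuation (v.adicCompletionIntegers K) (v.adicCompletion K)
  have hinjR := IsFractionRing.injective (Valuation.valuationSubring (Valuation.comap (algebraMap (maxUnramified (v.adicCompletion K)) (AlgebraicClosure (v.adicCompletion K))) w)) (maxUnramified (v.adicCompletion K))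
  have hinj₀ := IsFractionRing.injective (v.adicCompletionIntegers K) (v.adicCompletion K)
  -- the generator over `𝓞_v`
  obtain ⟨g₀, hg₀⟩ := exists_generator_of_tateNormalForm J hϖ h1 h2 h3 h4 hα hc h6
  /- the model `J' = J ⊗ 𝒪ⁿʳ`, a Tate normal form with the same `c` -/
  set J' := J.map φ with hJ'def
  have hϖ' : Irreducible (φ ϖ) := irreducible_map_of_coe_eq_algebraMap hw hφ hϖ
  have hα' : IsUnit (φ α) := (isUnit_map_iff hw hφ α).mpr hα
  have h1' : J'.a₁ = 1 := by rw [hJ'def, WeierstrassCurve.map_a₁, h1, map_one]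
  have h2' : J'.a₂ = 0 := by rw [hJ'def, WeierstrassCurve.map_a₂, h2, map_zero]
  have h3' : J'.a₃ = 0 := by rw [hJ'def, WeierstrassCurve.map_a₃, h3, map_zero]
  have h4' : J'.a₄ = 0 := by rw [hJ'def, WeierstrassCurve.map_a₄, h4, map_zero]
  have h6' : J'.a₆ = φ α * φ ϖ ^ c := by rw [hJ'def, WeierstrassCurve.map_a₆, h6, map_mul, map_pow]
  /- the three curves over `K_v^nr` and `K̄_v` -/
  have hJJ' : J.baseChange (maxUnramified (v.adicCompletion K)) = J'.baseChange (maxUnramified (v.adicCompletion K)) := by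
    change J.map (algebraMap _ _) = (J.map φ).map (algebraMap _ _)
    rw [WeierstrassCurve.map_map]
    congr 1
    refine RingHom.ext fun a ↦ Subtype.ext ?_
    change ((algebraMap (v.adicCompletionIntegers K) (maxUnramified (v.adicCompletion K)) a : (maxUnramified (v.adicCompletion K))) : AlgebraicClosure (v.adicCompletion K)) =
      (((φ a : (Valuation.valuationSubring (Valuation.comap (algebraMap (maxUnramified (v.adicCompletion K)) (AlgebraicClosure (v.adicCompletion K))) w))) : (maxUnramified (v.adicCompletion K))) : (AlgebraicClosure (v.adicCompletion K)))
    rw [hφ, IsScalarTower.algebraMap_apply (v.adicCompletionIntegers K) (v.adicCompletion K) (maxUnramified (v.adicCompletion K)), IntermediateField.coe_algebraMap_apply]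
    rfl
  have hJ'X : J'.baseChange (maxUnramified (v.adicCompletion K)) = (J.baseChange (v.adicCompletion K)).baseChange (maxUnramified (v.adicCompletion K)) := by
    rw [← hJJ']
    change J.map (algebraMap _ _) = (J.map (algebraMap _ _)).map (algebraMap _ _)
    rw [WeierstrassCurve.map_map, ← IsScalarTower.algebraMap_eq]
  have hW₀ : ((J'.map ψ).baseChange (AlgebraicClosure (v.adicCompletion K))) = (J.baseChange (v.adicCompletion K)).baseChange (AlgebraicClosure (v.adicCompletion K)) := by
    change ((J.map φ).map ψ).map (algebraMap _ _) = (J.map (algebraMap _ _)).map (algebraMap _ _)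
    rw [WeierstrassCurve.map_map, WeierstrassCurve.map_map, WeierstrassCurve.map_map]
    congr 1
    refine RingHom.ext fun a ↦ ?_
    change ((ψ (φ a) : w.integer) : (AlgebraicClosure (v.adicCompletion K))) = algebraMap (v.adicCompletion K) (AlgebraicClosure (v.adicCompletion K)) (algebraMap (v.adicCompletionIntegers K) (v.adicCompletion K) a)
    rw [hψ, hφ]
    rfl
  -- the residue field of `𝒪ⁿʳ` embeds into that of `𝒪_w`; `φ`, `ψ` are local
  haveI hψloc : IsLocalHom ψ := ⟨fun a ha ↦ by
    by_contra hna
    have hmem : a ∈ maximalIdeal (Valuation.valuationSubring (Valuation.comap (algebraMap (maxUnramified (v.adicCompletion K)) (AlgebraicClosure (v.adicCompletion K))) w)) :=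
      (IsLocalRing.mem_maximalIdeal _).mpr (mem_nonunits_iff.mpr hna)
    have := (map_mem_maximalIdeal_integer_iff hψ a).mpr hmem
    exact (mem_nonunits_iff.mp ((IsLocalRing.mem_maximalIdeal _).mp this)) ha⟩
  haveI hφloc : IsLocalHom φ := ⟨fun a ha ↦ (isUnit_map_iff hw hφ a).mp ha⟩
  have hκ : (J'.map ψ).map (residue w.integer) =
      ((J'.map (residue (Valuation.valuationSubring (Valuation.comap (algebraMap (maxUnramified (v.adicCompletion K)) (AlgebraicClosure (v.adicCompletion K))) w)))).map
        (IsLocalRing.ResidueField.map ψ)) := by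
    simp only [WeierstrassCurve.map_map]
    congr 1
  have hκ₀ : J'.map (residue (Valuation.valuationSubring (Valuation.comap (algebraMap (maxUnramified (v.adicCompletion K)) (AlgebraicClosure (v.adicCompletion K))) w))) =
      (J.map (residue (v.adicCompletionIntegers K))).map (IsLocalRing.ResidueField.map φ) := by
    rw [hJ'def]
    simp only [WeierstrassCurve.map_map]
    congr 1
  /- the maps on points -/
  set jK : (J.baseChange (v.adicCompletion K)).toAffine.Point →+ (J.baseChange (maxUnramified (v.adicCompletion K))).toAffine.Point :=
    WeierstrassCurve.Affine.Point.map (W' := J)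
      (IsScalarTower.toAlgHom (v.adicCompletionIntegers K) (v.adicCompletion K) (maxUnramified (v.adicCompletion K))) with hjK
  set e₀ := WeierstrassCurve.Affine.Point.congrEquiv hJJ' with he₀
  set e₁ := WeierstrassCurve.Affine.Point.congrEquiv hJ'X with he₁
  set ι : ((J.baseChange (v.adicCompletion K)).baseChange (maxUnramified (v.adicCompletion K))).toAffine.Point →+ ((J.baseChange (v.adicCompletion K)).baseChange (AlgebraicClosure (v.adicCompletion K))).toAffine.Point :=
    WeierstrassCurve.Affine.Point.map (W' := J.baseChange (v.adicCompletion K))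
      (IsScalarTower.toAlgHom (v.adicCompletion K) (maxUnramified (v.adicCompletion K)) (AlgebraicClosure (v.adicCompletion K))) with hι
  -- the composite on affine `K_v`-points: `(x, y) ↦ (x, y)` viewed in `K̄_v`
  have hcomp : ∀ (x y : v.adicCompletion K) (h : (J.baseChange (v.adicCompletion K)).toAffine.Nonsingular x y),
      ∃ h', ι (e₁ (e₀ (jK (.some x y h)))) =
        .some (algebraMap (v.adicCompletion K) (AlgebraicClosure (v.adicCompletion K)) x)
          (algebraMap (v.adicCompletion K) (AlgebraicClosure (v.adicCompletion K)) y) h' := by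
    intro x y h
    rw [hjK, WeierstrassCurve.Affine.Point.map_some, he₀, WeierstrassCurve.Affine.Point.congrEquiv_some,
      he₁, WeierstrassCurve.Affine.Point.congrEquiv_some, hι, WeierstrassCurve.Affine.Point.map_some]
    exact ⟨_, rfl⟩
  set g := ι (e₁ (e₀ (jK g₀))) with hgdef
  -- (2) images of `K_v^nr`-points are fixed by `I_𝔐`; images of `K_v`-points by everything
  have hfixι : ∀ (Q : ((J.baseChange (v.adicCompletion K)).baseChange (maxUnramified (v.adicCompletion K))).toAffine.Point),
      ∀ σ ∈ 𝔐.inertia (absoluteGaloisGroup (v.adicCompletion K)),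
        WeierstrassCurve.Affine.Point.map
          ((absoluteGaloisGroup.toAlgEquiv _ σ : (AlgebraicClosure (v.adicCompletion K)) ≃ₐ[(v.adicCompletion K)] (AlgebraicClosure (v.adicCompletion K))) : (AlgebraicClosure (v.adicCompletion K)) →ₐ[(v.adicCompletion K)] (AlgebraicClosure (v.adicCompletion K))) (ι Q) = ι Q := by
    intro Q σ hσ
    rcases Q with _ | ⟨x, y, h⟩
    · rfl
    · change WeierstrassCurve.Affine.Point.map _ (WeierstrassCurve.Affine.Point.some _ _ _) =
        WeierstrassCurve.Affine.Point.some _ _ _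
      rw [WeierstrassCurve.Affine.Point.map_some]
      exact point_some_congr (smul_coe_maxUnramified hw h𝔐 x hσ)
        (smul_coe_maxUnramified hw h𝔐 y hσ)
  have hfixg : ∀ (i : ℕ) (σ : absoluteGaloisGroup (v.adicCompletion K)),
      WeierstrassCurve.Affine.Point.map
        ((absoluteGaloisGroup.toAlgEquiv _ σ : (AlgebraicClosure (v.adicCompletion K)) ≃ₐ[(v.adicCompletion K)] (AlgebraicClosure (v.adicCompletion K))) : (AlgebraicClosure (v.adicCompletion K)) →ₐ[(v.adicCompletion K)] (AlgebraicClosure (v.adicCompletion K))) (i • g) = i • g := by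
    intro i σ
    rw [hgdef, show i • ι (e₁ (e₀ (jK g₀))) = ι (e₁ (e₀ (jK (i • g₀)))) by
      rw [map_nsmul, map_nsmul, map_nsmul, map_nsmul]]
    rcases hQ : i • g₀ with _ | ⟨x, y, h⟩
    · rw [show (WeierstrassCurve.Affine.Point.zero : (J.baseChange (v.adicCompletion K)).toAffine.Point) = 0 from rfl]
      simp only [map_zero]
    · obtain ⟨h', he⟩ := hcomp x y h
      rw [he, WeierstrassCurve.Affine.Point.map_some]
      exact point_some_congr (AlgEquiv.commutes _ x) (AlgEquiv.commutes _ y)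
  -- (3) `I_𝔐`-fixed points of `V` come from `K_v^nr`
  have hsurj : ∀ P : ((J.baseChange (v.adicCompletion K)).baseChange (AlgebraicClosure (v.adicCompletion K))).toAffine.Point,
      (∀ σ ∈ 𝔐.inertia (absoluteGaloisGroup (v.adicCompletion K)),
        WeierstrassCurve.Affine.Point.map
          ((absoluteGaloisGroup.toAlgEquiv _ σ : (AlgebraicClosure (v.adicCompletion K)) ≃ₐ[(v.adicCompletion K)] (AlgebraicClosure (v.adicCompletion K))) : (AlgebraicClosure (v.adicCompletion K)) →ₐ[(v.adicCompletion K)] (AlgebraicClosure (v.adicCompletion K))) P = P) →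
        ∃ Q, ι Q = P := by
    intro P hP
    rcases P with _ | ⟨x, y, h⟩
    · exact ⟨0, map_zero ι⟩
    · have hx : x ∈ (maxUnramified (v.adicCompletion K)) := (mem_maxUnramified_iff_forall_inertia hw h𝔐).mpr fun σ hσ ↦ by
        have := hP σ hσ
        rw [WeierstrassCurve.Affine.Point.map_some, WeierstrassCurve.Affine.Point.some.injEq] at this
        exact this.1
      have hy : y ∈ (maxUnramified (v.adicCompletion K)) := (mem_maxUnramified_iff_forall_inertia hw h𝔐).mpr fun σ hσ ↦ by
        have := hP σ hσ
        rw [WeierstrassCurve.Affine.Point.map_some, WeierstrassCurve.Affine.Point.some.injEq] at this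
        exact this.2
      have hinjι : Function.Injective (IsScalarTower.toAlgHom (v.adicCompletion K) (maxUnramified (v.adicCompletion K)) (AlgebraicClosure (v.adicCompletion K))) :=
        fun a b hab ↦ Subtype.ext hab
      have h₀ : ((J.baseChange (v.adicCompletion K)).baseChange (maxUnramified (v.adicCompletion K))).toAffine.Nonsingular ⟨x, hx⟩ ⟨y, hy⟩ :=
        (WeierstrassCurve.Affine.baseChange_nonsingular (W := J.baseChange (v.adicCompletion K))
          (f := IsScalarTower.toAlgHom (v.adicCompletion K) (maxUnramified (v.adicCompletion K)) (AlgebraicClosure (v.adicCompletion K))) hinjι ⟨x, hx⟩ ⟨y, hy⟩).mp h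
      exact ⟨.some _ _ h₀, rfl⟩
  -- (4) `E₀` of `J'` over `𝒪ⁿʳ` versus `E₀` over `𝒪_w`
  have hE₀ : ∀ Q : (J'.baseChange (maxUnramified (v.adicCompletion K))).toAffine.Point,
      J'.HasNonsingularReduction Q ↔ ReducesToNonsingular w (residue w.integer) (ι (e₁ Q)) := by
    intro Q
    rcases point_cases hvR Q with rfl | ⟨x, y, h, rfl, hx⟩ | ⟨a, b, h, rfl⟩
    · rw [map_zero, map_zero]
      exact ⟨fun _ ↦ reducesToNonsingular_zero, fun _ ↦ trivial⟩
    · have hx' : 1 < w (x : (AlgebraicClosure (v.adicCompletion K))) := not_le.mp fun hle ↦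
        (not_mem_range_iff hvR).mpr hx ⟨⟨x, (Valuation.mem_valuationSubring_iff _ _).mpr hle⟩, rfl⟩
      rw [he₁, WeierstrassCurve.Affine.Point.congrEquiv_some]
      exact ⟨fun _ ↦ reducesToNonsingular_of_one_lt hx', fun _ ↦ Or.inl ((not_mem_range_iff hvR).mpr hx)⟩
    · rw [WeierstrassCurve.hasNonsingularReduction_some_algebraMap_iff hinjR h, he₁,
        WeierstrassCurve.Affine.Point.congrEquiv_some, hι, WeierstrassCurve.Affine.Point.map_some]
      -- the coordinates in `K̄_v` are those of `ψ a`, `ψ b`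
      have hxa : (IsScalarTower.toAlgHom (v.adicCompletion K) (maxUnramified (v.adicCompletion K)) (AlgebraicClosure (v.adicCompletion K)))
            (algebraMap _ (maxUnramified (v.adicCompletion K)) a) =
          algebraMap w.integer (AlgebraicClosure (v.adicCompletion K)) (ψ a) := by
        change ((a : (maxUnramified (v.adicCompletion K))) : AlgebraicClosure (v.adicCompletion K)) = ((ψ a : w.integer) : AlgebraicClosure (v.adicCompletion K))
        rw [hψ]
      have hyb : (IsScalarTower.toAlgHom (v.adicCompletion K) (maxUnramified (v.adicCompletion K)) (AlgebraicClosure (v.adicCompletion K)))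
            (algebraMap _ (maxUnramified (v.adicCompletion K)) b) =
          algebraMap w.integer (AlgebraicClosure (v.adicCompletion K)) (ψ b) := by
        change ((b : (maxUnramified (v.adicCompletion K))) : AlgebraicClosure (v.adicCompletion K)) = ((ψ b : w.integer) : AlgebraicClosure (v.adicCompletion K))
        rw [hψ]
      have h'' : ((J'.map ψ).baseChange (AlgebraicClosure (v.adicCompletion K))).toAffine.Nonsingular
          (algebraMap w.integer (AlgebraicClosure (v.adicCompletion K)) (ψ a))
          (algebraMap w.integer (AlgebraicClosure (v.adicCompletion K)) (ψ b)) := by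
        rw [← hxa, ← hyb, hW₀]
        refine (WeierstrassCurve.Affine.baseChange_nonsingular (W := J.baseChange (v.adicCompletion K))
          (f := IsScalarTower.toAlgHom (v.adicCompletion K) (maxUnramified (v.adicCompletion K)) (AlgebraicClosure (v.adicCompletion K)))
          (fun a b hab ↦ Subtype.ext hab) _ _).mpr ?_
        change ((J.baseChange (v.adicCompletion K)).baseChange (maxUnramified (v.adicCompletion K))).toAffine.Nonsingular _ _
        rw [← hJ'X]
        exact h
      have h₃ : ((J.baseChange (v.adicCompletion K)).baseChange (AlgebraicClosure (v.adicCompletion K))).toAffine.Nonsingular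
          (algebraMap w.integer (AlgebraicClosure (v.adicCompletion K)) (ψ a))
          (algebraMap w.integer (AlgebraicClosure (v.adicCompletion K)) (ψ b)) := hW₀ ▸ h''
      rw [point_some_congr hxa hyb (h' := h₃)]
      -- transport to the `𝒪_w`-model `J' ⊗ 𝒪_w` of `V`
      rw [← (WeierstrassCurve.Affine.Point.congrEquiv hW₀).apply_symm_apply (WeierstrassCurve.Affine.Point.some _ _ h₃),
        reducesToNonsingular_congrEquiv_iff, reducesToNonsingular_iff_hasNonsingularReduction,
        WeierstrassCurve.Affine.Point.congrEquiv_symm_some,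
        WeierstrassCurve.hasNonsingularReduction_some_algebraMap_iff (Valuation.integer.integers w).hom_inj,
        hκ, ← IsLocalRing.ResidueField.map_residue, ← IsLocalRing.ResidueField.map_residue,
        WeierstrassCurve.Affine.map_nonsingular _ (IsLocalRing.ResidueField.map ψ).injective]
  -- `E₀` over `𝓞_v` versus `E₀` of `J'` over `𝒪ⁿʳ`, on `K_v`-points
  have hE₀K : ∀ Q : (J.baseChange (v.adicCompletion K)).toAffine.Point,
      J.HasNonsingularReduction Q ↔ J'.HasNonsingularReduction (e₀ (jK Q)) := by
    intro Q
    rcases point_cases hv₀ Q with rfl | ⟨x, y, h, rfl, hx⟩ | ⟨a, b, h, rfl⟩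
    · rw [map_zero, map_zero]
      exact ⟨fun _ ↦ trivial, fun _ ↦ trivial⟩
    · rw [hjK, WeierstrassCurve.Affine.Point.map_some, he₀, WeierstrassCurve.Affine.Point.congrEquiv_some]
      have hx₀ : x ∉ Set.range (algebraMap (v.adicCompletionIntegers K) (v.adicCompletion K)) :=
        (not_mem_range_iff hv₀).mpr hx
      have hxw : 1 < w (algebraMap (v.adicCompletion K) (AlgebraicClosure (v.adicCompletion K)) x) := by
        by_contra hle
        have hmem := (spectralValuation_algebraMap_le_one_iff hw x).mp (not_lt.mp hle)
        exact hx₀ ⟨⟨x, hmem⟩, rfl⟩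
      have hx' : ((IsScalarTower.toAlgHom (v.adicCompletionIntegers K) (v.adicCompletion K) (maxUnramified (v.adicCompletion K))) x : maxUnramified (v.adicCompletion K)) ∉
          Set.range (algebraMap (Valuation.valuationSubring (Valuation.comap (algebraMap (maxUnramified (v.adicCompletion K)) (AlgebraicClosure (v.adicCompletion K))) w)) (maxUnramified (v.adicCompletion K))) := by
        rintro ⟨r, hr⟩
        have h1 : w ((r : (maxUnramified (v.adicCompletion K))) : (AlgebraicClosure (v.adicCompletion K))) ≤ 1 :=
          coe_unrIntegers_le_one r
        have h2 : ((r : (maxUnramified (v.adicCompletion K))) : (AlgebraicClosure (v.adicCompletion K))) =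
            algebraMap (v.adicCompletion K) (AlgebraicClosure (v.adicCompletion K)) x := by
          change ((algebraMap _ (maxUnramified (v.adicCompletion K)) r : maxUnramified (v.adicCompletion K)) : AlgebraicClosure (v.adicCompletion K)) = _
          rw [hr]
          rfl
        rw [h2] at h1
        exact absurd h1 (not_le.mpr hxw)
      exact ⟨fun _ ↦ Or.inl hx', fun _ ↦ Or.inl hx₀⟩
    · rw [WeierstrassCurve.hasNonsingularReduction_some_algebraMap_iff hinj₀ h, hjK,
        WeierstrassCurve.Affine.Point.map_some, he₀, WeierstrassCurve.Affine.Point.congrEquiv_some]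
      have ha' : (IsScalarTower.toAlgHom (v.adicCompletionIntegers K) (v.adicCompletion K) (maxUnramified (v.adicCompletion K))) (algebraMap (v.adicCompletionIntegers K) (v.adicCompletion K) a) =
          algebraMap _ (maxUnramified (v.adicCompletion K)) (φ a) := by
        refine Subtype.ext ?_
        change ((algebraMap (v.adicCompletion K) (maxUnramified (v.adicCompletion K)) (algebraMap (v.adicCompletionIntegers K) (v.adicCompletion K) a) : maxUnramified (v.adicCompletion K)) : AlgebraicClosure (v.adicCompletion K)) =
          (((φ a : (Valuation.valuationSubring (Valuation.comap (algebraMap (maxUnramified (v.adicCompletion K)) (AlgebraicClosure (v.adicCompletion K))) w))) : (maxUnramified (v.adicCompletion K))) : (AlgebraicClosure (v.adicCompletion K)))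
        rw [hφ, IntermediateField.coe_algebraMap_apply]
        rfl
      have hb' : (IsScalarTower.toAlgHom (v.adicCompletionIntegers K) (v.adicCompletion K) (maxUnramified (v.adicCompletion K))) (algebraMap (v.adicCompletionIntegers K) (v.adicCompletion K) b) =
          algebraMap _ (maxUnramified (v.adicCompletion K)) (φ b) := by
        refine Subtype.ext ?_
        change ((algebraMap (v.adicCompletion K) (maxUnramified (v.adicCompletion K)) (algebraMap (v.adicCompletionIntegers K) (v.adicCompletion K) b) : maxUnramified (v.adicCompletion K)) : AlgebraicClosure (v.adicCompletion K)) =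
          (((φ b : (Valuation.valuationSubring (Valuation.comap (algebraMap (maxUnramified (v.adicCompletion K)) (AlgebraicClosure (v.adicCompletion K))) w))) : (maxUnramified (v.adicCompletion K))) : (AlgebraicClosure (v.adicCompletion K)))
        rw [hφ, IntermediateField.coe_algebraMap_apply]
        rfl
      have h'' : (J'.baseChange (maxUnramified (v.adicCompletion K))).toAffine.Nonsingular
          (algebraMap _ (maxUnramified (v.adicCompletion K)) (φ a)) (algebraMap _ (maxUnramified (v.adicCompletion K)) (φ b)) := by
        rw [← ha', ← hb', ← hJJ']
        exact (WeierstrassCurve.Affine.baseChange_nonsingular (W := J)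
          (f := IsScalarTower.toAlgHom (v.adicCompletionIntegers K) (v.adicCompletion K) (maxUnramified (v.adicCompletion K)))
          (fun a b hab ↦ by simpa using hab) _ _).mpr h
      rw [point_some_congr ha' hb' (h' := h''),
        WeierstrassCurve.hasNonsingularReduction_some_algebraMap_iff hinjR h'', hκ₀,
        ← IsLocalRing.ResidueField.map_residue, ← IsLocalRing.ResidueField.map_residue,
        WeierstrassCurve.Affine.map_nonsingular _ (IsLocalRing.ResidueField.map φ).injective]
  -- (a) the multiples of `g`
  have hmult : ∀ i : ℕ, ReducesToNonsingular w (IsLocalRing.residue w.integer) (i • g) ↔ c ∣ i := by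
    intro i
    rw [hgdef, show i • ι (e₁ (e₀ (jK g₀))) = ι (e₁ (e₀ (jK (i • g₀)))) by
      rw [map_nsmul, map_nsmul, map_nsmul, map_nsmul], ← hE₀, ← hE₀K]
    exact hg₀ i
  refine ⟨g, fun σ ↦ by simpa using hfixg 1 σ, hmult, fun P hP ↦ ?_⟩
  -- (b) the classes over `K_v^nr`
  set H' := J'.nonsingularReductionSubgroup hvR with hH'
  obtain ⟨Fi, hFi⟩ := natCard_quotient_le_of_tateNormalForm (K := maxUnramified (v.adicCompletion K)) J' hϖ' h1' h2' h3' h4' hα' hc h6'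
  haveI hfinQ : Finite ((J'.baseChange (maxUnramified (v.adicCompletion K))).toAffine.Point ⧸ H') :=
    Finite.of_injective Fi hFi
  have hcardle : Nat.card ((J'.baseChange (maxUnramified (v.adicCompletion K))).toAffine.Point ⧸ H') ≤ c := by
    simpa using Nat.card_le_card_of_injective Fi hFi
  -- the classes of `i • g₀'`, `i < c`, are distinct, hence exhaust the quotient
  set g' : (J'.baseChange (maxUnramified (v.adicCompletion K))).toAffine.Point := e₀ (jK g₀) with hg'def
  let cls : Fin c → (J'.baseChange (maxUnramified (v.adicCompletion K))).toAffine.Point ⧸ H' :=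
    fun i ↦ (((i : ℕ) • g' : (J'.baseChange (maxUnramified (v.adicCompletion K))).toAffine.Point) : _ ⧸ H')
  have hcls_inj : Function.Injective cls := by
    intro i j hij
    wlog hle : (i : ℕ) ≤ j generalizing i j
    · exact (this hij.symm (le_of_not_ge hle)).symm
    have hmem : ((j : ℕ) - i) • g' ∈ H' := by
      have h' : -((i : ℕ) • g') + (j : ℕ) • g' ∈ H' := QuotientAddGroup.eq.mp hij
      have e : ((j : ℕ) - i) • g' = (j : ℕ) • g' - (i : ℕ) • g' := by
        rw [sub_nsmul _ hle, sub_eq_add_neg]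
      rwa [neg_add_eq_sub, ← e] at h'
    have hmem' : J.HasNonsingularReduction (((j : ℕ) - i) • g₀) := by
      rw [hE₀K, map_nsmul, map_nsmul, ← hg'def]
      exact hmem
    have hdvd : c ∣ (j : ℕ) - i := (hg₀ _).mp hmem'
    have : (j : ℕ) - i = 0 := by
      rcases hdvd with ⟨k, hk⟩
      rcases Nat.eq_zero_or_pos k with rfl | hk0
      · simpa using hk
      · have : c ≤ (j : ℕ) - i := by rw [hk]; exact Nat.le_mul_of_pos_right c hk0
        have hj := j.2
        omega
    exact Fin.ext (by omega)
  have hcls_surj : Function.Surjective cls := by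
    haveI : Fintype ((J'.baseChange (maxUnramified (v.adicCompletion K))).toAffine.Point ⧸ H') := Fintype.ofFinite _
    have hbij : Function.Bijective cls := by
      rw [Fintype.bijective_iff_injective_and_card]
      refine ⟨hcls_inj, le_antisymm ?_ ?_⟩
      · exact Fintype.card_le_of_injective cls hcls_inj
      · rw [Fintype.card_fin, ← Nat.card_eq_fintype_card]
        exact hcardle
    exact hbij.2
  -- the point `P` comes from `K_v^nr`
  obtain ⟨P₀, rfl⟩ := hsurj P hP
  set Q₀ := e₁.symm P₀ with hQ₀
  obtain ⟨i, hi⟩ := hcls_surj (Q₀ : _ ⧸ H')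
  refine ⟨i, i.2, ?_⟩
  have hmem : Q₀ - (i : ℕ) • g' ∈ H' := by
    have h' : -((i : ℕ) • g') + Q₀ ∈ H' := QuotientAddGroup.eq.mp hi
    rwa [neg_add_eq_sub] at h'
  have hP₀ : ι P₀ = ι (e₁ Q₀) := by rw [hQ₀, AddEquiv.apply_symm_apply]
  rw [hP₀, hgdef, show (i : ℕ) • ι (e₁ g') = ι (e₁ ((i : ℕ) • g')) by rw [map_nsmul, map_nsmul],
    ← map_sub, ← map_sub, ← hE₀]
  exact hmem

/-! ## The Galois group acts trivially on `E(K_v^nr)/E₀(K_v^nr)` -/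

include hw in
/-- **`σP - P ∈ E₀` for every `σ ∈ Γ_{K_v}` and every `P ∈ E(K_v^nr)`** on the Tate normal form
at a split multiplicative place: the action of the Galois group on the component group
`E(K_v^nr)/E₀(K_v^nr) ≅ ℤ/c` is trivial (every class contains a `K_v`-rational point,
`exists_rational_generator_of_tateNormalForm`, and `E₀` is Galois stable,
`reducesToNonsingular_map_iff_of_forall_eq`).  In particular `Gal(L/K_v)` acts trivially on
`E(L)/E₀(L)` for every unramified `L/K_v` — the sentence "`G₀` acts trivially on it" of the proof
of Matsuno's Lemma 4.1 (and, on the Tate curve `E_q(K̄) = K̄^*/q^ℤ`, the Galois invariance of the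
valuation). [cite: Matsuno2009, Lemma 4.1 (proof, p. 454)] -/
theorem reducesToNonsingular_map_sub_of_tateNormalForm {𝔐 : Ideal v.localAbsIntegers}
    (h𝔐 : 𝔐 ∈ v.localPrimesAbove) (J : WeierstrassCurve (v.adicCompletionIntegers K))
    {ϖ α : v.adicCompletionIntegers K} {c : ℕ} (hϖ : Irreducible ϖ) (h1 : J.a₁ = 1)
    (h2 : J.a₂ = 0) (h3 : J.a₃ = 0) (h4 : J.a₄ = 0) (hα : IsUnit α) (hc : 1 ≤ c)
    (h6 : J.a₆ = α * ϖ ^ c) (σ : absoluteGaloisGroup (v.adicCompletion K))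
    (P : ((J.baseChange (v.adicCompletion K)).baseChange (AlgebraicClosure (v.adicCompletion K))).toAffine.Point)
    (hP : ∀ τ ∈ 𝔐.inertia (absoluteGaloisGroup (v.adicCompletion K)),
      WeierstrassCurve.Affine.Point.map ((absoluteGaloisGroup.toAlgEquiv _ τ :
        AlgebraicClosure (v.adicCompletion K) ≃ₐ[v.adicCompletion K] AlgebraicClosure (v.adicCompletion K)) :
        AlgebraicClosure (v.adicCompletion K) →ₐ[v.adicCompletion K] AlgebraicClosure (v.adicCompletion K)) P = P) :
    ReducesToNonsingular w (IsLocalRing.residue w.integer)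
      (WeierstrassCurve.Affine.Point.map ((absoluteGaloisGroup.toAlgEquiv _ σ :
        AlgebraicClosure (v.adicCompletion K) ≃ₐ[v.adicCompletion K] AlgebraicClosure (v.adicCompletion K)) :
        AlgebraicClosure (v.adicCompletion K) →ₐ[v.adicCompletion K] AlgebraicClosure (v.adicCompletion K)) P - P) := by
  obtain ⟨g, hgσ, -, hcls⟩ := exists_rational_generator_of_tateNormalForm hw h𝔐 J hϖ h1 h2 h3 h4 hα hc h6
  obtain ⟨i, -, hi⟩ := hcls P hP
  -- an `𝒪_w`-model of `V`, to use `ReducesToNonsingular.sub`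
  obtain ⟨φ, hφ⟩ := exists_ringHom_adicCompletionIntegers_unrIntegers hw
  obtain ⟨ψ, hψ⟩ := exists_ringHom_unrIntegers_integer (w := w) (v := v) (K := K)
  set θ : v.adicCompletionIntegers K →+* w.integer := ψ.comp φ with hθdef
  have hθ : ∀ a, ((θ a : w.integer) : AlgebraicClosure (v.adicCompletion K)) =
      algebraMap (v.adicCompletion K) (AlgebraicClosure (v.adicCompletion K)) a := fun a ↦ by
    rw [hθdef, RingHom.comp_apply, hψ, hφ]
  have hW₀ : (J.map θ).baseChange (AlgebraicClosure (v.adicCompletion K)) =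
      (J.baseChange (v.adicCompletion K)).baseChange (AlgebraicClosure (v.adicCompletion K)) := by
    change (J.map θ).map (algebraMap _ _) = (J.map (algebraMap _ _)).map (algebraMap _ _)
    rw [WeierstrassCurve.map_map, WeierstrassCurve.map_map]
    congr 1
    exact RingHom.ext fun a ↦ hθ a
  haveI : ((J.baseChange (v.adicCompletion K)).baseChange (AlgebraicClosure (v.adicCompletion K))).IsIntegral w.integer :=
    ⟨J.map θ, hW₀.symm⟩
  have hσw : ∀ z, w (((absoluteGaloisGroup.toAlgEquiv _ σ :
      AlgebraicClosure (v.adicCompletion K) ≃ₐ[v.adicCompletion K] AlgebraicClosure (v.adicCompletion K)) :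
      AlgebraicClosure (v.adicCompletion K) →ₐ[v.adicCompletion K] AlgebraicClosure (v.adicCompletion K)) z) = w z :=
    fun z ↦ spectralValuation_smul hw σ z
  have hig : WeierstrassCurve.Affine.Point.map ((absoluteGaloisGroup.toAlgEquiv _ σ :
      AlgebraicClosure (v.adicCompletion K) ≃ₐ[v.adicCompletion K] AlgebraicClosure (v.adicCompletion K)) :
      AlgebraicClosure (v.adicCompletion K) →ₐ[v.adicCompletion K] AlgebraicClosure (v.adicCompletion K)) (i • g) = i • g := by
    rw [map_nsmul, hgσ σ]
  -- `σP - P = σ(P - i g) - (P - i g)`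
  have key : WeierstrassCurve.Affine.Point.map ((absoluteGaloisGroup.toAlgEquiv _ σ :
        AlgebraicClosure (v.adicCompletion K) ≃ₐ[v.adicCompletion K] AlgebraicClosure (v.adicCompletion K)) :
        AlgebraicClosure (v.adicCompletion K) →ₐ[v.adicCompletion K] AlgebraicClosure (v.adicCompletion K)) P - P =
      WeierstrassCurve.Affine.Point.map ((absoluteGaloisGroup.toAlgEquiv _ σ :
        AlgebraicClosure (v.adicCompletion K) ≃ₐ[v.adicCompletion K] AlgebraicClosure (v.adicCompletion K)) :
        AlgebraicClosure (v.adicCompletion K) →ₐ[v.adicCompletion K] AlgebraicClosure (v.adicCompletion K)) (P - i • g) - (P - i • g) := by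
    rw [map_sub, hig]; abel
  rw [key]
  have h1' := (reducesToNonsingular_map_iff_of_forall_eq (J.baseChange (v.adicCompletion K)) _ hσw (P - i • g)).mpr hi
  -- subtraction inside `E₀` (through the `𝒪_w`-model)
  have hsub := ReducesToNonsingular.sub (J.map θ)
    (P := (WeierstrassCurve.Affine.Point.congrEquiv hW₀).symm (WeierstrassCurve.Affine.Point.map ((absoluteGaloisGroup.toAlgEquiv _ σ :
        AlgebraicClosure (v.adicCompletion K) ≃ₐ[v.adicCompletion K] AlgebraicClosure (v.adicCompletion K)) :
        AlgebraicClosure (v.adicCompletion K) →ₐ[v.adicCompletion K] AlgebraicClosure (v.adicCompletion K)) (P - i • g)))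
    (Q := (WeierstrassCurve.Affine.Point.congrEquiv hW₀).symm (P - i • g))
    ((reducesToNonsingular_congrEquiv_iff (w := w) (r := IsLocalRing.residue w.integer) (h := hW₀) (P := _)).mp
      (by rw [AddEquiv.apply_symm_apply]; exact h1'))
    ((reducesToNonsingular_congrEquiv_iff (w := w) (r := IsLocalRing.residue w.integer) (h := hW₀) (P := _)).mp
      (by rw [AddEquiv.apply_symm_apply]; exact hi))
  rw [← map_sub] at hsub
  have hsub' := (reducesToNonsingular_congrEquiv_iff (w := w) (r := IsLocalRing.residue w.integer) (h := hW₀) (P := _)).mpr hsub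
  rwa [AddEquiv.apply_symm_apply] at hsub'

end IsDedekindDomain.HeightOneSpectrum
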